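import Summits.PneNP.PneNP.Theses.KarlinRubin
import Summits.PneNP.PneNP.Theorems.KarlinRubinMonotoneSufficesTransportBridge
import Summits.PneNP.PneNP.Theorems.KarlinRubinMonotoneSufficesStubShiftCount
import Summits.PneNP.PneNP.Theorems.KarlinRubinMonotoneSufficesStubShiftTail
import Summits.PneNP.PneNP.Theorems.KarlinRubinMonotoneSufficesStubShiftRatio
import Literature.Computability.Complexity.Rossman2008CliqueProofs

/-!
# Crux `MonotoneSuffices` (stmt-PneNP-18026), line `Sketch` — density-shift rung: the finite
# SHIFT LEMMA (`stub_shiftErrSum`)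

A detector with one LAYER of negation gates has the form `f(x) = F(x, ¬g⃗(x))`, `F` monotone in the
wires (a `{∧₂,∨₂,0,1}`-circuit on the inputs plus the wires) and every `g_j` monotone. The
density-shift rung replaces the input `x : EdgeVec n` by the UP-SHIFT `x ∨ 1_R`
(`fun e => x e || [e ∈ R]`) for an `r`-subset `R` of the `N = C(n,2)` edge slots and freezes the
wires to a constant pattern `b`. This file proves the finite, every-`k` error estimate behind it:

* null side: `{F(z, b) = 1} ⊆ {f(z) = 1} ∪ {∃ j, b_j = 1 ∧ g_j(z) = 1}` (`shiftErrSum_null_subset`);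
* planted side: planting commutes with the shift (`shiftErrSum_plant_ins`) and
  `{F(plant_A z, b) = 0} ⊆ {f(plant_A z) = 0} ∪ {∃ j, b_j = 0 ∧ g_j(z) = 0}` (`shiftErrSum_planted_subset`,
  monotonicity of `g_j` moves the bad event from `plant_A z` down to `z`);
* the law of `z = x ∨ 1_R` for a uniformly random `r`-set `R` (`stub_shiftCount`, W1) costs at most the
  likelihood ratio `e^{2ur/N}` on the slices `≤ N/2 + u` (`stub_shiftRatio`, W3) plus the mass
  `N/(u-r+1)²` above them (`stub_shiftTail`, W2): `shiftErrSum_sum_card_le` (counts),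
  `shiftErrSum_sum_measure_le` (probabilities of `G(n,1/2)`, for an arbitrary event);
* summing over `R`, fibring the planted law over the planted set
  (`SliceTransport.plantedCliqueDist_apply_eq_sum`) and choosing the best `R`
  (`ENNReal.exists_le_of_sum_le`): `stub_shiftErrSum` — some `r`-set `R` achieves
  `errSum(F(· ∨ 1_R, b)) ≤ e^{2ur/N} · errSum(f) + 2N/(u-r+1)² + 2 · avg_R Pr₀[∃ j, g_j(x ∨ 1_R) = b_j]`,
  for EVERY clique size `k` (no condition relating `k` and `n`: the shift acts before planting).
-/

set_option linter.dupNamespace false -- `Summit.PneNP.PneNP.…`: summit = sub-problem name (D-0017)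

namespace Summit.PneNP.PneNP.Theorems.MonotoneSuffices.DensityShift

open Literature.Computability.Complexity Literature.Probability.RandomGraphs.PlantedClique Filter Finset
open scoped ENNReal

/-! ### Pointwise facts: the two inclusions and the commutation with planting -/

/-- **Null-side inclusion.** If `F x` is monotone in the wires then `F z b = 1` forces `f z = 1` or a
wire frozen to `1` whose gate reads `1`: otherwise `b ≤ ¬g⃗(z)` componentwise. [folklore] -/
theorem shiftErrSum_null_subset {V κ : Type*} (F : V → (κ → Bool) → Bool) (g : κ → V → Bool)
    (b : κ → Bool) (hF : ∀ x, Monotone (F x)) (z : V) (hz : F z b = true) :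
    F z (fun j => !g j z) = true ∨ ∃ j, b j = true ∧ g j z = true := by
  by_cases h : ∃ j, b j = true ∧ g j z = true
  · exact Or.inr h
  · left
    push Not at h
    have hle : b ≤ fun j => !g j z := fun j => by
      cases hb : b j
      · exact Bool.false_le _
      · have := h j hb
        simp [this]
    have := hF z hle
    rw [hz] at this
    exact Bool.eq_true_of_true_le this

/-- **Planted-side inclusion.** If `F y` is monotone in the wires, every `g_j` is monotone and
`z ≤ y`, then `F y b = 0` forces `f y = 0` or a wire frozen to `0` whose gate reads `0` already at
`z`: otherwise `¬g⃗(y) ≤ b` componentwise. [folklore] -/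
theorem shiftErrSum_planted_subset {V κ : Type*} [Preorder V] (F : V → (κ → Bool) → Bool)
    (g : κ → V → Bool) (b : κ → Bool) (hF : ∀ x, Monotone (F x)) (hg : ∀ j, Monotone (g j))
    {z y : V} (hzy : z ≤ y) (hy : F y b = false) :
    F y (fun j => !g j y) = false ∨ ∃ j, b j = false ∧ g j z = false := by
  by_cases h : ∃ j, b j = false ∧ g j z = false
  · exact Or.inr h
  · left
    push Not at h
    have hle : (fun j => !g j y) ≤ b := fun j => by
      cases hgy : g j y
      · -- `g j y = 0` forces `g j z = 0`, hence `b j = 1`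
        have hgz : g j z = false := by
          have hm := hg j hzy
          rw [hgy] at hm
          cases hz : g j z
          · rfl
          · rw [hz] at hm; exact absurd hm (by decide)
        have hb : b j = true := by
          have := h j
          cases hb : b j
          · exact absurd hgz (by simpa using this hb)
          · rfl
        simp [hb]
      · show (!g j y) ≤ b j
        rw [hgy]
        exact Bool.false_le _
    have := hF y hle
    rw [hy] at this
    cases hv : F y (fun j => !g j y)
    · rfl
    · rw [hv] at this; exact absurd this (by decide)

/-- **Planting commutes with the up-shift**: `plant A (x ∨ 1_R) = (plant A x) ∨ 1_R`. [folklore] -/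
theorem shiftErrSum_plant_ins {n : ℕ} (A : Finset (Fin n)) (R : Finset ((⊤ : SimpleGraph (Fin n)).edgeSet))
    (x : EdgeVec n) :
    (fun e => plant A x e || decide (e ∈ R)) = plant A (fun e => x e || decide (e ∈ R)) := by
  classical
  funext e
  simp only [plant]
  cases x e <;> cases decide (e ∈ R) <;> simp

/-! ### The law of the shifted input: counts, then `G(n,1/2)`-probabilities -/

/-- **Counting form of the shift estimate** (generic cube). Summed over all `r`-sets `R`, the number
of `x` whose up-shift lands in `A` is at most `C(N,r) · (e^{2ur/N} · #A + 2^N · N/(u-r+1)²)`: the law of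
the shift (`stub_shiftCount`), the likelihood ratio on the slices `≤ N/2 + u` (`stub_shiftRatio`) and the
mass above them (`stub_shiftTail`). [folklore] -/
theorem shiftErrSum_sum_card_le {α : Type*} [Fintype α] [DecidableEq α] (A : Finset (α → Bool))
    {r u : ℕ} (hru : r ≤ u) (hN : 0 < Fintype.card α) :
    ((∑ R ∈ (univ : Finset α).powersetCard r,
        #((univ : Finset (α → Bool)).filter fun x => (fun a => x a || decide (a ∈ R)) ∈ A) : ℕ) : ℝ) ≤
      ((Fintype.card α).choose r : ℝ) *
        (Real.exp (2 * (u : ℝ) * r / Fintype.card α) * #A +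
          2 ^ Fintype.card α * ((Fintype.card α : ℝ) / ((u : ℝ) - r + 1) ^ 2)) := by
  set N := Fintype.card α with hNdef
  rw [stub_shiftCount A r]
  push_cast
  -- split `A` at the slice `N/2 + u`
  set w : (α → Bool) → ℝ := fun y => ((#(univ.filter fun a => y a = true)).choose r : ℝ) with hw
  have hsplit := (sum_filter_add_sum_filter_not A (fun y => #(univ.filter fun a => y a = true) ≤ N / 2 + u) w).symm
  have hlow : ∑ y ∈ A.filter (fun y => #(univ.filter fun a => y a = true) ≤ N / 2 + u), w y ≤
      #A * ((min (N / 2 + u) N).choose r : ℝ) := by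
    calc ∑ y ∈ A.filter (fun y => #(univ.filter fun a => y a = true) ≤ N / 2 + u), w y
        ≤ ∑ _y ∈ A.filter (fun y => #(univ.filter fun a => y a = true) ≤ N / 2 + u),
            ((min (N / 2 + u) N).choose r : ℝ) := by
          refine sum_le_sum fun y hy => ?_
          have hy' := (mem_filter.1 hy).2
          have hyN : #(univ.filter fun a => y a = true) ≤ N := (card_le_univ _).trans_eq hNdef.symm
          simp only [hw]
          exact_mod_cast Nat.choose_le_choose r (le_min hy' hyN)
      _ = #(A.filter (fun y => #(univ.filter fun a => y a = true) ≤ N / 2 + u)) *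
            ((min (N / 2 + u) N).choose r : ℝ) := by rw [sum_const, nsmul_eq_mul]
      _ ≤ #A * ((min (N / 2 + u) N).choose r : ℝ) := by
          gcongr
          exact filter_subset _ _
  have hhigh : ∑ y ∈ A.filter (fun y => ¬ #(univ.filter fun a => y a = true) ≤ N / 2 + u), w y ≤
      ∑ y ∈ (univ : Finset (α → Bool)).filter (fun y => N / 2 + u < #(univ.filter fun a => y a = true)), w y := by
    refine sum_le_sum_of_subset_of_nonneg (fun y hy => ?_) fun y _ _ => by positivity
    rw [mem_filter] at hy ⊢
    exact ⟨mem_univ _, not_le.1 hy.2⟩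
  have hratio := stub_shiftRatio N r u hN
  have htail := stub_shiftTail (α := α) r u hru
  rw [← hNdef] at htail
  have h2r : (0 : ℝ) ≤ 2 ^ r := by positivity
  calc (2 : ℝ) ^ r * ∑ y ∈ A, w y
      = 2 ^ r * (∑ y ∈ A.filter (fun y => #(univ.filter fun a => y a = true) ≤ N / 2 + u), w y) +
          2 ^ r * (∑ y ∈ A.filter (fun y => ¬ #(univ.filter fun a => y a = true) ≤ N / 2 + u), w y) := by
        rw [hsplit, mul_add]
    _ ≤ 2 ^ r * (#A * ((min (N / 2 + u) N).choose r : ℝ)) +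
          2 ^ r * ∑ y ∈ (univ : Finset (α → Bool)).filter
            (fun y => N / 2 + u < #(univ.filter fun a => y a = true)), w y := by
        gcongr
    _ = #A * (2 ^ r * ((min (N / 2 + u) N).choose r : ℝ)) +
          2 ^ r * ∑ y ∈ (univ : Finset (α → Bool)).filter
            (fun y => N / 2 + u < #(univ.filter fun a => y a = true)), w y := by ring
    _ ≤ #A * ((N.choose r : ℝ) * Real.exp (2 * (u : ℝ) * r / N)) +
          (N.choose r : ℝ) * 2 ^ N * ((N : ℝ) / ((u : ℝ) - r + 1) ^ 2) := by
        gcongr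
    _ = _ := by ring

/-- `G(n,1/2)`-probabilities are at most `1`, hence finite. [folklore] -/
theorem shiftErrSum_erdosRenyiHalf_ne_top {n : ℕ} (S : Set (EdgeVec n)) :
    (erdosRenyiHalf n).toOuterMeasure S ≠ ⊤ :=
  ne_top_of_le_ne_top ENNReal.one_ne_top
    (((erdosRenyiHalf n).toOuterMeasure.mono (Set.subset_univ S)).trans_eq
      ((PMF.toOuterMeasure_apply_eq_one_iff _ _).2 (Set.subset_univ _)))

/-- **Probability form of the shift estimate.** For every test `h` on the edge vectors of `Kₙ`
(`N = C(n,2) > 0`, `r ≤ u`): summed over all `r`-sets `R` of edge slots,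
`∑_R Pr₀[h(x ∨ 1_R)] ≤ C(N,r) · (e^{2ur/N} · Pr₀[h] + N/(u-r+1)²)`. [folklore] -/
theorem shiftErrSum_sum_measure_le {n r u : ℕ} (h : EdgeVec n → Bool) (hru : r ≤ u) (hN : 0 < n.choose 2) :
    ∑ R ∈ (univ : Finset ((⊤ : SimpleGraph (Fin n)).edgeSet)).powersetCard r,
        (erdosRenyiHalf n).toOuterMeasure {x | h (fun e => x e || decide (e ∈ R)) = true} ≤
      ((n.choose 2).choose r : ℝ≥0∞) *
        (ENNReal.ofReal (Real.exp (2 * (u : ℝ) * r / n.choose 2)) *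
            (erdosRenyiHalf n).toOuterMeasure {x | h x = true} +
          ENNReal.ofReal ((n.choose 2 : ℝ) / ((u : ℝ) - r + 1) ^ 2)) := by
  classical
  have hcard : Fintype.card ((⊤ : SimpleGraph (Fin n)).edgeSet) = n.choose 2 := card_edgeSet_top_fin n
  set P := (univ : Finset ((⊤ : SimpleGraph (Fin n)).edgeSet)).powersetCard r with hP
  set A : Finset (EdgeVec n) := univ.filter fun y => h y = true with hA
  -- the counting estimate, specialised to the edge cube
  have hcount := shiftErrSum_sum_card_le (α := (⊤ : SimpleGraph (Fin n)).edgeSet) A hru (hcard ▸ hN)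
  rw [hcard] at hcount
  -- identify the summands with counts
  have hterm : ∀ R : Finset ((⊤ : SimpleGraph (Fin n)).edgeSet),
      ((erdosRenyiHalf n).toOuterMeasure {x | h (fun e => x e || decide (e ∈ R)) = true}).toReal =
        (#((univ : Finset (EdgeVec n)).filter fun x => (fun a => x a || decide (a ∈ R)) ∈ A) : ℝ) /
          2 ^ n.choose 2 := by
    intro R
    rw [SliceTransport.toReal_erdosRenyiHalf_eq (fun x => h (fun e => x e || decide (e ∈ R)))]
    congr 2
    exact congrArg Finset.card (Finset.ext fun x => by simp only [hA, mem_filter, mem_univ, true_and])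
  have hA' : ((erdosRenyiHalf n).toOuterMeasure {x | h x = true}).toReal = (#A : ℝ) / 2 ^ n.choose 2 :=
    SliceTransport.toReal_erdosRenyiHalf_eq h
  -- pass to `toReal`
  have hfinL : ∑ R ∈ P, (erdosRenyiHalf n).toOuterMeasure {x | h (fun e => x e || decide (e ∈ R)) = true} ≠ ⊤ :=
    ENNReal.sum_ne_top.2 fun R _ => shiftErrSum_erdosRenyiHalf_ne_top _
  have hfinR : ((n.choose 2).choose r : ℝ≥0∞) *
        (ENNReal.ofReal (Real.exp (2 * (u : ℝ) * r / n.choose 2)) *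
            (erdosRenyiHalf n).toOuterMeasure {x | h x = true} +
          ENNReal.ofReal ((n.choose 2 : ℝ) / ((u : ℝ) - r + 1) ^ 2)) ≠ ⊤ := by
    refine ENNReal.mul_ne_top (ENNReal.natCast_ne_top _) (ENNReal.add_ne_top.2 ⟨?_, ENNReal.ofReal_ne_top⟩)
    exact ENNReal.mul_ne_top ENNReal.ofReal_ne_top (shiftErrSum_erdosRenyiHalf_ne_top _)
  rw [← ENNReal.toReal_le_toReal hfinL hfinR, ENNReal.toReal_sum (fun R _ => shiftErrSum_erdosRenyiHalf_ne_top _),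
    ENNReal.toReal_mul, ENNReal.toReal_add (ENNReal.mul_ne_top ENNReal.ofReal_ne_top
      (shiftErrSum_erdosRenyiHalf_ne_top _)) ENNReal.ofReal_ne_top, ENNReal.toReal_mul,
    ENNReal.toReal_ofReal (Real.exp_nonneg _), ENNReal.toReal_ofReal (by positivity), ENNReal.toReal_natCast,
    hA']
  simp_rw [hterm]
  rw [← sum_div, div_le_iff₀ (by positivity)]
  have h2N : (0 : ℝ) < 2 ^ n.choose 2 := by positivity
  calc ∑ R ∈ P, (#((univ : Finset (EdgeVec n)).filter fun x => (fun a => x a || decide (a ∈ R)) ∈ A) : ℝ)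
      = ((∑ R ∈ P, #((univ : Finset (EdgeVec n)).filter fun x => (fun a => x a || decide (a ∈ R)) ∈ A) : ℕ) : ℝ) := by
        push_cast; rfl
    _ ≤ ((n.choose 2).choose r : ℝ) * (Real.exp (2 * (u : ℝ) * r / n.choose 2) * #A +
          2 ^ n.choose 2 * ((n.choose 2 : ℝ) / ((u : ℝ) - r + 1) ^ 2)) := hcount
    _ = ((n.choose 2).choose r : ℝ) * (Real.exp (2 * (u : ℝ) * r / n.choose 2) * ((#A : ℝ) / 2 ^ n.choose 2) +
          (n.choose 2 : ℝ) / ((u : ℝ) - r + 1) ^ 2) * 2 ^ n.choose 2 := by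
        field_simp

/-! ### Assembly: the finite shift lemma -/

/-- Averaging a constant against the uniform law on the planted sets. [folklore] -/
theorem shiftErrSum_sum_uniform_mul {n k : ℕ} (c : ℝ≥0∞) :
    ∑ A ∈ kSubsets n k, (PMF.uniformOfFinset (kSubsets n k) (kSubsets_nonempty n k)) A * c = c := by
  rw [← sum_mul]
  have h1 : ∑ A ∈ kSubsets n k, (PMF.uniformOfFinset (kSubsets n k) (kSubsets_nonempty n k)) A = 1 := by
    rw [sum_congr rfl fun A hA => PMF.uniformOfFinset_apply_of_mem (kSubsets_nonempty n k) hA, sum_const,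
      nsmul_eq_mul]
    exact ENNReal.mul_inv_cancel (Nat.cast_ne_zero.2 (kSubsets_nonempty n k).card_pos.ne')
      (ENNReal.natCast_ne_top _)
  rw [h1, one_mul]

/-- **`stub_shiftErrSum` — the finite SHIFT LEMMA** (registered stub of stmt-PneNP-18026, line `Sketch`,
density-shift rung). Let `F x` be monotone in the wires and every `g_j` monotone, `f(x) = F(x, ¬g⃗(x))`,
`r ≤ u`, `r ≤ N = C(n,2) > 0`. Then SOME `r`-set `R` of edge slots satisfies, for every clique size `k`,
`errSum_k(F(· ∨ 1_R, b)) ≤ e^{2ur/N} · errSum_k(f) + 2N/(u-r+1)² + 2 · avg_{R'} Pr₀[∃ j, g_j(x ∨ 1_{R'}) = b_j]`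
(`errSum_k` = type I under `G(n,1/2)` + type II under the planted `k`-clique). Proof: per `R`, the null
error is at most `Pr₀[f(x ∨ 1_R)] + bad(R)` (`shiftErrSum_null_subset`) and the planted error at most
`E_A Pr₀[¬f(plant_A(x ∨ 1_R))] + bad(R)` (fibre over the planted set, the shift commutes with planting,
`shiftErrSum_planted_subset`); summed over `R` both transported terms cost the likelihood ratio and the
tail (`shiftErrSum_sum_measure_le`, with `E_A Pr₀[¬f ∘ plant_A] = Pr₁[¬f]`); the best `R` is at most the
average (`ENNReal.exists_le_of_sum_le`). [folklore] -/
theorem stub_shiftErrSum :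
    ∀ (n k r u : ℕ) {κ : Type*} (F : EdgeVec n → (κ → Bool) → Bool) (g : κ → EdgeVec n → Bool)
      (b : κ → Bool),
      (∀ x, Monotone (F x)) → (∀ j, Monotone (g j)) → r ≤ u → r ≤ n.choose 2 → 0 < n.choose 2 →
      ∃ R ∈ (univ : Finset ((⊤ : SimpleGraph (Fin n)).edgeSet)).powersetCard r,
        (erdosRenyiHalf n).toOuterMeasure {x | F (fun e => x e || decide (e ∈ R)) b = true} +
            (plantedCliqueDist n k).toOuterMeasure {x | F (fun e => x e || decide (e ∈ R)) b = false} ≤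
          ENNReal.ofReal (Real.exp (2 * (u : ℝ) * r / n.choose 2)) *
              ((erdosRenyiHalf n).toOuterMeasure {x | F x (fun j => !g j x) = true} +
                (plantedCliqueDist n k).toOuterMeasure {x | F x (fun j => !g j x) = false}) +
            ENNReal.ofReal (2 * (n.choose 2 : ℝ) / ((u : ℝ) - r + 1) ^ 2) +
            2 * (∑ R' ∈ (univ : Finset ((⊤ : SimpleGraph (Fin n)).edgeSet)).powersetCard r,
                (erdosRenyiHalf n).toOuterMeasure {x | ∃ j, g j (fun e => x e || decide (e ∈ R')) = b j}) /
              ((n.choose 2).choose r : ℝ≥0∞) := by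
  intro n k r u κ F g b hF hg hru hrN hN
  classical
  -- notation
  set P := (univ : Finset ((⊤ : SimpleGraph (Fin n)).edgeSet)).powersetCard r with hP
  set uA := PMF.uniformOfFinset (kSubsets n k) (kSubsets_nonempty n k) with huA
  set c : ℝ≥0∞ := ENNReal.ofReal (Real.exp (2 * (u : ℝ) * r / n.choose 2)) with hc
  set t : ℝ≥0∞ := ENNReal.ofReal ((n.choose 2 : ℝ) / ((u : ℝ) - r + 1) ^ 2) with ht
  set bad : Finset ((⊤ : SimpleGraph (Fin n)).edgeSet) → ℝ≥0∞ := fun R =>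
    (erdosRenyiHalf n).toOuterMeasure {x | ∃ j, g j (fun e => x e || decide (e ∈ R)) = b j} with hbad
  set f : EdgeVec n → Bool := fun y => F y (fun j => !g j y) with hf
  have hcardE : Fintype.card ((⊤ : SimpleGraph (Fin n)).edgeSet) = n.choose 2 := card_edgeSet_top_fin n
  have hPcard : (#P : ℝ≥0∞) = ((n.choose 2).choose r : ℝ≥0∞) := by
    rw [hP, card_powersetCard, card_univ, hcardE]
  have hPne : P.Nonempty := powersetCard_nonempty.2 (by rw [card_univ, hcardE]; exact hrN)
  have hC0 : ((n.choose 2).choose r : ℝ≥0∞) ≠ 0 := by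
    rw [← hPcard]; exact Nat.cast_ne_zero.2 hPne.card_pos.ne'
  have hCtop : ((n.choose 2).choose r : ℝ≥0∞) ≠ ⊤ := ENNReal.natCast_ne_top _
  -- (1) null side, per `R`
  have hnull : ∀ R : Finset ((⊤ : SimpleGraph (Fin n)).edgeSet),
      (erdosRenyiHalf n).toOuterMeasure {x | F (fun e => x e || decide (e ∈ R)) b = true} ≤
        (erdosRenyiHalf n).toOuterMeasure {x | f (fun e => x e || decide (e ∈ R)) = true} + bad R := by
    intro R
    refine le_trans (MeasureTheory.measure_mono fun x hx => ?_) (MeasureTheory.measure_union_le _ _)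
    rcases shiftErrSum_null_subset F g b hF (fun e => x e || decide (e ∈ R)) hx with h | ⟨j, hbj, hgj⟩
    · exact Or.inl h
    · exact Or.inr ⟨j, hgj.trans hbj.symm⟩
  -- (2) planted side, per `R`: fibre over the planted set, the shift commutes with planting
  have hplanted : ∀ R : Finset ((⊤ : SimpleGraph (Fin n)).edgeSet),
      (plantedCliqueDist n k).toOuterMeasure {x | F (fun e => x e || decide (e ∈ R)) b = false} ≤
        (∑ A ∈ kSubsets n k, uA A *
            (erdosRenyiHalf n).toOuterMeasure {x | f (plant A (fun e => x e || decide (e ∈ R))) = false}) +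
          bad R := by
    intro R
    rw [SliceTransport.plantedCliqueDist_apply_eq_sum (fun x => F (fun e => x e || decide (e ∈ R)) b)]
    have hfib : ∀ A : Finset (Fin n),
        (erdosRenyiHalf n).toOuterMeasure {x | F (fun e => plant A x e || decide (e ∈ R)) b = false} ≤
          (erdosRenyiHalf n).toOuterMeasure {x | f (plant A (fun e => x e || decide (e ∈ R))) = false} +
            bad R := by
      intro A
      refine le_trans (MeasureTheory.measure_mono fun x hx => ?_) (MeasureTheory.measure_union_le _ _)
      have hx' : F (plant A (fun e => x e || decide (e ∈ R))) b = false := by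
        rw [← shiftErrSum_plant_ins]; exact hx
      rcases shiftErrSum_planted_subset F g b hF hg
          (show (fun e => x e || decide (e ∈ R)) ≤ plant A (fun e => x e || decide (e ∈ R)) from
            fun e => le_plant A (fun e => x e || decide (e ∈ R)) e) hx' with h | ⟨j, hbj, hgj⟩
      · exact Or.inl h
      · exact Or.inr ⟨j, hgj.trans hbj.symm⟩
    calc ∑ A ∈ kSubsets n k, uA A *
          (erdosRenyiHalf n).toOuterMeasure {x | F (fun e => plant A x e || decide (e ∈ R)) b = false}
        ≤ ∑ A ∈ kSubsets n k, uA A *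
            ((erdosRenyiHalf n).toOuterMeasure {x | f (plant A (fun e => x e || decide (e ∈ R))) = false} +
              bad R) := sum_le_sum fun A _ => mul_le_mul_right (hfib A) _
      _ = (∑ A ∈ kSubsets n k, uA A *
            (erdosRenyiHalf n).toOuterMeasure {x | f (plant A (fun e => x e || decide (e ∈ R))) = false}) +
            ∑ A ∈ kSubsets n k, uA A * bad R := by
          rw [← sum_add_distrib]
          exact sum_congr rfl fun A _ => mul_add _ _ _
      _ = _ := by rw [shiftErrSum_sum_uniform_mul]
  -- (3) the transported null term, summed over `R`
  have hsumNull : ∑ R ∈ P, (erdosRenyiHalf n).toOuterMeasure {x | f (fun e => x e || decide (e ∈ R)) = true} ≤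
      ((n.choose 2).choose r : ℝ≥0∞) * (c * (erdosRenyiHalf n).toOuterMeasure {x | f x = true} + t) :=
    shiftErrSum_sum_measure_le f hru hN
  -- (4) the transported planted term, summed over `R`
  have hsumPl : ∑ R ∈ P, ∑ A ∈ kSubsets n k, uA A *
        (erdosRenyiHalf n).toOuterMeasure {x | f (plant A (fun e => x e || decide (e ∈ R))) = false} ≤
      ((n.choose 2).choose r : ℝ≥0∞) * (c * (plantedCliqueDist n k).toOuterMeasure {x | f x = false} + t) := by
    rw [sum_comm]
    have hA : ∀ A : Finset (Fin n), ∑ R ∈ P,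
        (erdosRenyiHalf n).toOuterMeasure {x | f (plant A (fun e => x e || decide (e ∈ R))) = false} ≤
          ((n.choose 2).choose r : ℝ≥0∞) *
            (c * (erdosRenyiHalf n).toOuterMeasure {x | f (plant A x) = false} + t) := by
      intro A
      have h := shiftErrSum_sum_measure_le (fun y => !f (plant A y)) hru hN
      have e1 : ∀ R : Finset ((⊤ : SimpleGraph (Fin n)).edgeSet),
          {x : EdgeVec n | (!f (plant A (fun e => x e || decide (e ∈ R)))) = true} =
            {x | f (plant A (fun e => x e || decide (e ∈ R))) = false} := fun R => Set.ext fun x => by simp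
      have e2 : {x : EdgeVec n | (!f (plant A x)) = true} = {x | f (plant A x) = false} := Set.ext fun x => by simp
      simp only [e1, e2] at h
      exact h
    calc ∑ A ∈ kSubsets n k, ∑ R ∈ P, uA A *
          (erdosRenyiHalf n).toOuterMeasure {x | f (plant A (fun e => x e || decide (e ∈ R))) = false}
        = ∑ A ∈ kSubsets n k, uA A * ∑ R ∈ P,
            (erdosRenyiHalf n).toOuterMeasure {x | f (plant A (fun e => x e || decide (e ∈ R))) = false} := by
          refine sum_congr rfl fun A _ => ?_
          rw [mul_sum]
      _ ≤ ∑ A ∈ kSubsets n k, uA A * (((n.choose 2).choose r : ℝ≥0∞) *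
            (c * (erdosRenyiHalf n).toOuterMeasure {x | f (plant A x) = false} + t)) :=
          sum_le_sum fun A _ => mul_le_mul_right (hA A) _
      _ = ((n.choose 2).choose r : ℝ≥0∞) * (c * (∑ A ∈ kSubsets n k, uA A *
            (erdosRenyiHalf n).toOuterMeasure {x | f (plant A x) = false}) + t) := by
          have hsplit : ∀ A : Finset (Fin n), uA A * (((n.choose 2).choose r : ℝ≥0∞) *
              (c * (erdosRenyiHalf n).toOuterMeasure {x | f (plant A x) = false} + t)) =
              ((n.choose 2).choose r : ℝ≥0∞) * c *
                (uA A * (erdosRenyiHalf n).toOuterMeasure {x | f (plant A x) = false}) +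
              uA A * (((n.choose 2).choose r : ℝ≥0∞) * t) := fun A => by ring
          simp only [hsplit, sum_add_distrib, ← mul_sum]
          rw [shiftErrSum_sum_uniform_mul]
          ring
      _ = _ := by rw [← SliceTransport.plantedCliqueDist_apply_eq_sum f]
  -- (5) sum of the error sums over `R`, and the target constant
  set B : ℝ≥0∞ := c * ((erdosRenyiHalf n).toOuterMeasure {x | f x = true} +
      (plantedCliqueDist n k).toOuterMeasure {x | f x = false}) +
    ENNReal.ofReal (2 * (n.choose 2 : ℝ) / ((u : ℝ) - r + 1) ^ 2) +
    2 * (∑ R' ∈ P, bad R') / ((n.choose 2).choose r : ℝ≥0∞) with hB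
  have h2t : ENNReal.ofReal (2 * (n.choose 2 : ℝ) / ((u : ℝ) - r + 1) ^ 2) = 2 * t := by
    rw [ht, mul_div_assoc, ENNReal.ofReal_mul (by norm_num), ENNReal.ofReal_ofNat]
  have htotal : ∑ R ∈ P, ((erdosRenyiHalf n).toOuterMeasure {x | F (fun e => x e || decide (e ∈ R)) b = true} +
      (plantedCliqueDist n k).toOuterMeasure {x | F (fun e => x e || decide (e ∈ R)) b = false}) ≤
      ∑ _R ∈ P, B := by
    calc ∑ R ∈ P, ((erdosRenyiHalf n).toOuterMeasure {x | F (fun e => x e || decide (e ∈ R)) b = true} +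
          (plantedCliqueDist n k).toOuterMeasure {x | F (fun e => x e || decide (e ∈ R)) b = false})
        ≤ ∑ R ∈ P, (((erdosRenyiHalf n).toOuterMeasure {x | f (fun e => x e || decide (e ∈ R)) = true} + bad R) +
            ((∑ A ∈ kSubsets n k, uA A *
              (erdosRenyiHalf n).toOuterMeasure {x | f (plant A (fun e => x e || decide (e ∈ R))) = false}) +
              bad R)) := sum_le_sum fun R _ => add_le_add (hnull R) (hplanted R)
      _ = (∑ R ∈ P, (erdosRenyiHalf n).toOuterMeasure {x | f (fun e => x e || decide (e ∈ R)) = true}) +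
            (∑ R ∈ P, ∑ A ∈ kSubsets n k, uA A *
              (erdosRenyiHalf n).toOuterMeasure {x | f (plant A (fun e => x e || decide (e ∈ R))) = false}) +
            2 * ∑ R ∈ P, bad R := by
          simp only [sum_add_distrib, two_mul]
          ring
      _ ≤ ((n.choose 2).choose r : ℝ≥0∞) * (c * (erdosRenyiHalf n).toOuterMeasure {x | f x = true} + t) +
            ((n.choose 2).choose r : ℝ≥0∞) * (c * (plantedCliqueDist n k).toOuterMeasure {x | f x = false} + t) +
            2 * ∑ R ∈ P, bad R := add_le_add (add_le_add hsumNull hsumPl) le_rfl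
      _ = ((n.choose 2).choose r : ℝ≥0∞) * B := by
          have hRHS : ((n.choose 2).choose r : ℝ≥0∞) * B =
              ((n.choose 2).choose r : ℝ≥0∞) * (c * ((erdosRenyiHalf n).toOuterMeasure {x | f x = true} +
                (plantedCliqueDist n k).toOuterMeasure {x | f x = false})) +
              ((n.choose 2).choose r : ℝ≥0∞) * (2 * t) + 2 * ∑ R' ∈ P, bad R' := by
            rw [hB, h2t, mul_add, mul_add, ENNReal.mul_div_cancel hC0 hCtop]
          rw [hRHS]
          ring
      _ = ∑ _R ∈ P, B := by rw [sum_const, nsmul_eq_mul, hPcard]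
  obtain ⟨R, hRP, hR⟩ := ENNReal.exists_le_of_sum_le hPne htotal
  exact ⟨R, hRP, by simpa only [hB, hf] using hR⟩

end Summit.PneNP.PneNP.Theorems.MonotoneSuffices.DensityShift
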